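import Literature.Computability.QuantumComplexity.HybridArgument
import HarnessLib

/-!
# Replacing the oracle gates of a quantum circuit one by one (Aaronson–Chen 2017, proofs of Lemma 5.3 and Lemma 8.2)

Topic `Computability/QuantumComplexity` (family `quantum-advantage`). This file PROVES, in the
tree's model of oracle quantum computation (Q2: circuits `QCircuit G N` over a gate set `G` with
XOR-query oracle gates `QGate.oracle k e`, semantics `QCircuit.toMatrix A`), the state-vector
analysis common to the two simulation lemmas of

* S. Aaronson, L. Chen, *Complexity-theoretic foundations of quantum supremacy experiments*,
  CCC 2017 (arXiv:1612.05903) [AaronsonChen2017]: **Lemma 5.3** (§5.3, `SampBQP^{TQBF,O}` is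
  simulated in `SampBPP^{TQBF,O}` for `O ∼ 𝒟_O`) and **Lemma 8.2** (§8, the PAC-learning simulation
  behind Thm. 8.1, tree fact `Literature.Barriers.QuantumAdvantage.aaronsonChen2017_lem82`).

**The printed argument** (arXiv pp. 21–23 and 32–33). Write the unitary of the circuit as
`U = U_{T+1} (U_{f_{n_T}} ⊗ I) ⋯ U_2 (U_{f_{n_1}} ⊗ I) U_1`, the `U_i` oracle-free and the `t`-th
oracle gate an `f_{n_t}` gate; "our algorithm proceeds by replacing each `O`-gate by a much simpler
gate, one by one": the `t`-th oracle gate is replaced by a `g_t` gate, giving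
`V = U_{T+1} (U_{g_T} ⊗ I) ⋯ (U_{g_1} ⊗ I) U_1` (the circuit `C_final`). With
`|v_t⟩ = U_t (U_{g_{t-1}} ⊗ I) ⋯ (U_{g_1} ⊗ I) U_1 |0^N⟩`, "the quantum state right before the
`t`-th `O` gate in the circuit AFTER the replacement" (p. 22, p. 32), the deviation of one
replacement is `‖((U_f − U_g) ⊗ I)|v⟩‖² = 4 · Pr_{i∼Q}[f(i) ≠ g(i)]` (eqs. (4)–(5) p. 22,
eq. (13) p. 32), `Q` the distribution of the query register of `|v⟩`; and by induction
(eq. `close-vt-2`, p. 23) `‖ |v_t⟩ − |u_t⟩ ‖ ≤ ∑_{s<t} ‖((U_{f_s} − U_{g_s}) ⊗ I)|v_s⟩‖`, whence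
`‖U|0^N⟩ − V|0^N⟩‖ ≤ ∑_t 2 √(Pr_{i∼Q_t}[f(i) ≠ g_t(i)])` ("`≤ 2T√ε₁ = ε²/8`" in Lemma 8.2 once every
`Pr_{i∼Q_t}[f(i) ≠ g_t(i)] ≤ ε₁`, p. 33).

**What is proved here** (all `theorem`s, no named facts), for the tree's XOR query
`|q, b⟩ ↦ |q, b ⊕ [q ∈ A]⟩` (for which the one-gate identity is the inequality `≤ 4 · Pr`, tree
lemma `normSq_oracleGate_sub_mulVec_le` of `HybridArgument.lean`):

* `replMatrix g i gs` — the unitary `V` of the gate list `gs` in which the oracle gate number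
  `i + t` (its `t`-th oracle gate) queries the language `g (i + t)` instead of the oracle
  (`replMatrix_const`: all `g t = A` gives back `QCircuit.toMatrix A`; `replMatrix_mem_unitaryGroup`);
* `replQueryWeights g D i gs ψ` — the list of query magnitudes `q_{D_t}(|v_t⟩)` of the sets `D t`
  at the successive oracle gates, the states `|v_t⟩` taken along the REPLACED run
  (`length_replQueryWeights`, `replQueryWeights_nonneg`);
* `l2Norm_toMatrix_sub_replMatrix_le` — **the per-gate hybrid bound**: if `g t` and `A` agree
  outside `D t` for every `t`, then `‖U^A_C ψ − V ψ‖₂ ≤ ∑_t 2 √(q_{D_t}(|v_t⟩))`;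
* `l2Norm_toMatrix_sub_replMatrix_le_of_forall_le` — the uniform form
  `‖U^A_C ψ − V ψ‖₂ ≤ 2 · T · √ε₁` when every `q_{D_t}(|v_t⟩) ≤ ε₁`, `T` the number of oracle gates
  (Aaronson–Chen's "`2T · √ε₁`").

The passage from state vectors to output distributions (Aaronson–Chen Cor. 2.5; in the tree the
sharper linear bound of BBBV Thm. 3.1) and the identification of `q_D(|v⟩)` with
`Pr_{i∼Q}[i ∈ D]` for the query-register marginal `Q` are in the sibling
`OracleGateReplacementBorn.lean`.

## Design notes

* The replaced gates are again XOR-query gates, for per-gate languages `g t : Language Bool`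
  (Aaronson–Chen's `g_t : {0,1}^{n_t} → {0,1}`, read as the language `{w | g_t w = 1}`; only its
  length-`n_t` slice matters). This is the right generality for both lemmas: in Lemma 5.3 `g_t`
  is a sparse table, in Lemma 8.2 a circuit of `SIZE(q(n))`; how `U_{g_t}` is further compiled
  into oracle-free gates is a separate (machine-level) matter.
* Oracle gates are numbered by an explicit counter `i` threaded through the gate list (the `t`-th
  oracle gate of `gs`, counting from `i`), so that statements about suffixes are available for the
  inductions; users take `i = 0`.
* The comparison oracle `A` is the same at every gate (the true oracle `f`); the hypothesis is
  `∀ t, ∀ w ∉ D t, (w ∈ g t ↔ w ∈ A)`, typically with `D t = {w | (w ∈ g t) ≠ (w ∈ A)}` itself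
  (`l2Norm_toMatrix_sub_replMatrix_le'`).

## Sources

* [AaronsonChen2017] arXiv:1612.05903, read via `lit read arxiv:1612.05903`: §5.3 pp. 21–23
  (proof of Lemma 5.3: decomposition of `U`, `|v⟩`, eqs. (4)–(5), `C_final`, `V`, `|u_t⟩`, `|v_t⟩`,
  eq. `close-vt-2` and its induction), §8 pp. 32–33 (proof of Lemma 8.2: eq. (13), "`δ₁ = ε/2T`,
  `ε₁ = ε⁴/256T²` … `‖U|0⟩ − V|0⟩‖ ≤ 2T·√ε₁ = ε²/8`").
* [BennettBernsteinBrassardVazirani1997] Thm. 3.3 (the hybrid argument), as proved in the tree's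
  `HybridArgument.lean` (`l2Norm_toMatrix_sub_le`, the special case `g t = B` for all `t`).
-/

noncomputable section

namespace Literature.Computability.QuantumComplexity

open Matrix

variable {G : Cryptography.QGateSet} {N : ℕ}

/-! ### The circuit after replacing its oracle gates -/

/-- The oracle-gate counter after a gate: unchanged by a gate symbol, incremented by an oracle
gate. [folklore] -/
def _root_.Literature.Computability.Cryptography.QGate.nextIdx : Cryptography.QGate G N → ℕ → ℕ
  | .gate _ _, i => i
  | .oracle _ _, i => i + 1

/-- `nextIdx` of a gate symbol (definitional). [folklore] -/
@[simp] theorem _root_.Literature.Computability.Cryptography.QGate.nextIdx_gate (s : G.Op)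
    (e : Fin (G.arity s) ↪ Fin N) (i : ℕ) :
    (Cryptography.QGate.gate s e : Cryptography.QGate G N).nextIdx i = i := rfl

/-- `nextIdx` of an oracle gate (definitional). [folklore] -/
@[simp] theorem _root_.Literature.Computability.Cryptography.QGate.nextIdx_oracle (k : ℕ)
    (e : Fin (k + 1) ↪ Fin N) (i : ℕ) :
    (Cryptography.QGate.oracle k e : Cryptography.QGate G N).nextIdx i = i + 1 := rfl

/-- **The circuit after the replacement** (Aaronson–Chen's `V = U_{T+1} (U_{g_T} ⊗ I) ⋯ (U_{g_1} ⊗ I) U_1`):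
the matrix of the gate list `gs` in which the oracle gate met with counter value `t` (the
`(t - i)`-th oracle gate of `gs` when started at `i`) is the XOR-query gate of the language `g t`,
while gate symbols keep their matrices; the head of the list acts first.
[cite: AaronsonChen2017, §5.3 (proof of Lemma 5.3, the circuit C_final and V, p. 23) and §8 (proof of Lemma 8.2, p. 33)] -/
def replMatrix (g : ℕ → Language Bool) :
    ℕ → List (Cryptography.QGate G N) → Matrix (Cryptography.QReg N) (Cryptography.QReg N) ℂ
  | _, [] => 1
  | i, x :: gs => replMatrix g (x.nextIdx i) gs * x.toMatrix (g i)

/-- The empty circuit is the identity after replacement too. [folklore] -/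
@[simp] theorem replMatrix_nil (g : ℕ → Language Bool) (i : ℕ) :
    replMatrix g i ([] : List (Cryptography.QGate G N)) = 1 := rfl

/-- Unfolding: the head gate acts first, with the oracle `g i` if it is an oracle gate. [folklore] -/
theorem replMatrix_cons (g : ℕ → Language Bool) (i : ℕ) (x : Cryptography.QGate G N)
    (gs : List (Cryptography.QGate G N)) :
    replMatrix g i (x :: gs) = replMatrix g (x.nextIdx i) gs * x.toMatrix (g i) := rfl

/-- Replacing every oracle gate by a query to the same language `A` gives back the circuit run
with the oracle `A`: `V = U` when all `g_t = f`. [folklore] -/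
theorem replMatrix_const (A : Language Bool) :
    ∀ (i : ℕ) (gs : List (Cryptography.QGate G N)),
      replMatrix (fun _ => A) i gs = (⟨gs⟩ : Cryptography.QCircuit G N).toMatrix A
  | _, [] => by simp
  | i, x :: gs => by
    rw [replMatrix_cons, Cryptography.QCircuit.toMatrix_cons, replMatrix_const A (x.nextIdx i) gs]

/-- Over a unitary gate set the replaced circuit is unitary (each factor is a placed unitary or a
placed XOR-query gate). [folklore] -/
theorem replMatrix_mem_unitaryGroup (hG : G.IsUnitary) (g : ℕ → Language Bool) :
    ∀ (i : ℕ) (gs : List (Cryptography.QGate G N)),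
      replMatrix g i gs ∈ Matrix.unitaryGroup (Cryptography.QReg N) ℂ
  | _, [] => by simp
  | i, x :: gs => by
    rw [replMatrix_cons]
    exact Submonoid.mul_mem _ (replMatrix_mem_unitaryGroup hG g _ gs)
      (Cryptography.QGate.toMatrix_mem_unitaryGroup_holds hG (g i) x)

/-- The replaced circuit preserves the `ℓ²`-norm. [folklore] -/
theorem l2Norm_replMatrix_mulVec (hG : G.IsUnitary) (g : ℕ → Language Bool) (i : ℕ)
    (gs : List (Cryptography.QGate G N)) (ψ : Cryptography.QReg N → ℂ) :
    l2Norm (replMatrix g i gs *ᵥ ψ) = l2Norm ψ :=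
  l2Norm_mulVec_of_mem_unitaryGroup (replMatrix_mem_unitaryGroup hG g i gs) ψ

/-- The replaced circuit preserves `normSq` (unit vectors stay unit vectors). [folklore] -/
theorem normSq_replMatrix_mulVec (hG : G.IsUnitary) (g : ℕ → Language Bool) (i : ℕ)
    (gs : List (Cryptography.QGate G N)) (ψ : Cryptography.QReg N → ℂ) :
    Cryptography.normSq (replMatrix g i gs *ᵥ ψ) = Cryptography.normSq ψ :=
  Cryptography.normSq_mulVec_of_mem_unitaryGroup (replMatrix_mem_unitaryGroup hG g i gs) ψ

/-! ### Query magnitudes along the replaced run -/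

/-- **The query magnitudes of the replaced run**: the list, over the successive oracle gates of
`gs` (counter started at `i`), of `q_{D t}(|v_t⟩)`, the query magnitude (`queryWeight`) of the set
`D t` at the oracle gate with counter `t` in the state `|v_t⟩` just before it IN THE CIRCUIT AFTER
THE REPLACEMENT (the earlier oracle gates answered by `g`). For `D t = {w | (w ∈ g t) ≠ (w ∈ f)}`
this is Aaronson–Chen's `Pr_{i∼Q_t}[f(i) ≠ g_t(i)]` (sibling file, `queryWeight_eq_queryMarginal`).
[cite: AaronsonChen2017, §5.3 (proof of Lemma 5.3, |v⟩ and eq. (5), p. 22) and §8 (proof of Lemma 8.2, p. 32)] -/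
def replQueryWeights (g : ℕ → Language Bool) (D : ℕ → Set (List Bool)) :
    ℕ → List (Cryptography.QGate G N) → (Cryptography.QReg N → ℂ) → List ℝ
  | _, [], _ => []
  | i, x :: gs, ψ => x.queryWeights (D i) ψ ++ replQueryWeights g D (x.nextIdx i) gs (x.toMatrix (g i) *ᵥ ψ)

/-- No oracle gate, no query magnitude. [folklore] -/
@[simp] theorem replQueryWeights_nil (g : ℕ → Language Bool) (D : ℕ → Set (List Bool)) (i : ℕ)
    (ψ : Cryptography.QReg N → ℂ) :
    replQueryWeights g D i ([] : List (Cryptography.QGate G N)) ψ = [] := rfl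

/-- Unfolding of `replQueryWeights` at the head gate. [folklore] -/
theorem replQueryWeights_cons (g : ℕ → Language Bool) (D : ℕ → Set (List Bool)) (i : ℕ)
    (x : Cryptography.QGate G N) (gs : List (Cryptography.QGate G N)) (ψ : Cryptography.QReg N → ℂ) :
    replQueryWeights g D i (x :: gs) ψ =
      x.queryWeights (D i) ψ ++ replQueryWeights g D (x.nextIdx i) gs (x.toMatrix (g i) *ᵥ ψ) := rfl

/-- There is one query magnitude per oracle gate (`T` entries). [folklore] -/
theorem length_replQueryWeights (g : ℕ → Language Bool) (D : ℕ → Set (List Bool)) :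
    ∀ (i : ℕ) (gs : List (Cryptography.QGate G N)) (ψ : Cryptography.QReg N → ℂ),
      (replQueryWeights g D i gs ψ).length = (⟨gs⟩ : Cryptography.QCircuit G N).oracleQueries
  | _, [], _ => rfl
  | i, x :: gs, ψ => by
    have ih := length_replQueryWeights g D (x.nextIdx i) gs (x.toMatrix (g i) *ᵥ ψ)
    unfold Cryptography.QCircuit.oracleQueries at ih ⊢
    cases x with
    | gate s e =>
      simp only [replQueryWeights, Cryptography.QGate.queryWeights, List.nil_append]
      rw [List.filter_cons_of_neg (by simp [Cryptography.QGate.IsOracleFree])]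
      exact ih
    | oracle k e =>
      simp only [replQueryWeights, Cryptography.QGate.queryWeights, List.singleton_append,
        List.length_cons]
      rw [List.filter_cons_of_pos (by simp [Cryptography.QGate.IsOracleFree]), List.length_cons, ih]

/-- Query magnitudes are nonnegative. [folklore] -/
theorem replQueryWeights_nonneg (g : ℕ → Language Bool) (D : ℕ → Set (List Bool)) :
    ∀ (i : ℕ) (gs : List (Cryptography.QGate G N)) (ψ : Cryptography.QReg N → ℂ),
      ∀ q ∈ replQueryWeights g D i gs ψ, 0 ≤ q
  | _, [], _ => by simp
  | i, x :: gs, ψ => by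
    intro q hq
    rw [replQueryWeights_cons, List.mem_append] at hq
    rcases hq with hq | hq
    · cases x with
      | gate s e => simp [Cryptography.QGate.queryWeights] at hq
      | oracle k e =>
        simp only [Cryptography.QGate.queryWeights, List.mem_singleton] at hq
        rw [hq]
        exact queryWeight_nonneg _ _ _
    · exact replQueryWeights_nonneg g D _ gs _ q hq

/-- Query magnitudes of unit vectors are at most `1`. [folklore] -/
theorem replQueryWeights_le_one (hG : G.IsUnitary) (g : ℕ → Language Bool) (D : ℕ → Set (List Bool)) :
    ∀ (i : ℕ) (gs : List (Cryptography.QGate G N)) (ψ : Cryptography.QReg N → ℂ),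
      Cryptography.normSq ψ = 1 → ∀ q ∈ replQueryWeights g D i gs ψ, q ≤ 1
  | _, [], _, _ => by simp
  | i, x :: gs, ψ, hψ => by
    intro q hq
    rw [replQueryWeights_cons, List.mem_append] at hq
    rcases hq with hq | hq
    · cases x with
      | gate s e => simp [Cryptography.QGate.queryWeights] at hq
      | oracle k e =>
        simp only [Cryptography.QGate.queryWeights, List.mem_singleton] at hq
        rw [hq, ← hψ]
        exact queryWeight_le_normSq _ _ _
    · refine replQueryWeights_le_one hG g D _ gs _ ?_ q hq
      rw [Cryptography.normSq_mulVec_of_mem_unitaryGroup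
        (Cryptography.QGate.toMatrix_mem_unitaryGroup_holds hG (g i) x), hψ]

/-! ### The per-gate hybrid bound -/

/-- **Replacing the oracle gates one by one costs at most `∑_t 2 √(q_{D_t}(|v_t⟩))`**
(Aaronson–Chen, proofs of Lemma 5.3 and Lemma 8.2; the per-gate form of BBBV's hybrid argument).
Over a unitary gate set, if for every `t` the replacement language `g t` agrees with the oracle `A`
outside the set `D t`, then for every state `ψ`
`‖U^A_{gs} ψ − V_g ψ‖₂ ≤ ∑_t 2 √(q_{D_t}(|v_t⟩))`, where `|v_t⟩` is the state just before the `t`-th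
oracle gate of the REPLACED run: by induction on the gate list,
`U^A (x ψ) − V (x_g ψ) = [U^A (x_A ψ) − U^A (x_g ψ)] + [U^A (x_g ψ) − V (x_g ψ)]`, the first term has
norm `‖x_A ψ − x_g ψ‖₂ ≤ 2 √(q_{D}(ψ))` by unitarity of `U^A` and the one-gate bound
(`l2Norm_gate_sub_le`), the second is the induction hypothesis at the next state of the replaced
run. [cite: AaronsonChen2017, §5.3 (proof of Lemma 5.3, eqs. (4)–(5) p. 22 and eq. close-vt-2 p. 23) and §8 (proof of Lemma 8.2, eq. (13) p. 32)] -/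
theorem l2Norm_toMatrix_sub_replMatrix_le (hG : G.IsUnitary) {A : Language Bool}
    {g : ℕ → Language Bool} {D : ℕ → Set (List Bool)}
    (hD : ∀ t w, w ∉ D t → (w ∈ g t ↔ w ∈ A)) :
    ∀ (i : ℕ) (gs : List (Cryptography.QGate G N)) (ψ : Cryptography.QReg N → ℂ),
      l2Norm ((⟨gs⟩ : Cryptography.QCircuit G N).toMatrix A *ᵥ ψ - replMatrix g i gs *ᵥ ψ) ≤
        ((replQueryWeights g D i gs ψ).map fun q => 2 * Real.sqrt q).sum
  | _, [], ψ => by simp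
  | i, x :: gs, ψ => by
    have ih := l2Norm_toMatrix_sub_replMatrix_le hG hD (x.nextIdx i) gs (x.toMatrix (g i) *ᵥ ψ)
    rw [Cryptography.QCircuit.toMatrix_cons, replMatrix_cons, ← Matrix.mulVec_mulVec,
      ← Matrix.mulVec_mulVec, replQueryWeights_cons, List.map_append, List.sum_append]
    refine (l2Norm_sub_le _
      ((⟨gs⟩ : Cryptography.QCircuit G N).toMatrix A *ᵥ (x.toMatrix (g i) *ᵥ ψ)) _).trans
      (add_le_add ?_ ih)
    rw [← Matrix.mulVec_sub, l2Norm_mulVec_of_mem_unitaryGroup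
      (Cryptography.QCircuit.toMatrix_mem_unitaryGroup_holds hG A ⟨gs⟩)]
    exact l2Norm_gate_sub_le (hD i) x ψ

/-- The same with the canonical choice `D t = {w | (w ∈ g t) ≠ (w ∈ A)}` of the disagreement sets
(Aaronson–Chen's `[f(i) ≠ g(i)]`). [cite: AaronsonChen2017, §5.3 (proof of Lemma 5.3, eq. (5) p. 22) and §8 (proof of Lemma 8.2, eq. (13) p. 32)] -/
theorem l2Norm_toMatrix_sub_replMatrix_le' (hG : G.IsUnitary) (A : Language Bool)
    (g : ℕ → Language Bool) (i : ℕ) (gs : List (Cryptography.QGate G N)) (ψ : Cryptography.QReg N → ℂ) :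
    l2Norm ((⟨gs⟩ : Cryptography.QCircuit G N).toMatrix A *ᵥ ψ - replMatrix g i gs *ᵥ ψ) ≤
      ((replQueryWeights g (fun t => {w | (w ∈ g t) ≠ (w ∈ A)}) i gs ψ).map
        fun q => 2 * Real.sqrt q).sum :=
  l2Norm_toMatrix_sub_replMatrix_le hG (fun t w hw => by
    simp only [Set.mem_setOf_eq, ne_eq, not_not] at hw
    exact Iff.of_eq hw) i gs ψ

/-- A sum of `2 √q` over a list whose entries are at most `ε₁` is at most `2 · |l| · √ε₁`. [folklore] -/
theorem sum_map_two_mul_sqrt_le_of_forall_le {l : List ℝ} {ε₁ : ℝ} (h : ∀ q ∈ l, q ≤ ε₁) :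
    (l.map fun q => 2 * Real.sqrt q).sum ≤ 2 * (l.length : ℝ) * Real.sqrt ε₁ := by
  induction l with
  | nil => simp
  | cons a l ih =>
    simp only [List.map_cons, List.sum_cons, List.length_cons, Nat.cast_succ]
    have ha : Real.sqrt a ≤ Real.sqrt ε₁ := Real.sqrt_le_sqrt (h a (by simp))
    have hl := ih fun q hq => h q (by simp [hq])
    nlinarith [Real.sqrt_nonneg ε₁]

/-- **The uniform form** ("`‖U|0^N⟩ − V|0^N⟩‖ ≤ 2T · √ε₁`", Aaronson–Chen p. 33): if every oracle
gate's replacement errs with query magnitude at most `ε₁` along the replaced run, the final states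
differ by at most `2 · T · √ε₁` in `ℓ²`-norm, `T` the number of oracle gates.
[cite: AaronsonChen2017, §8 (proof of Lemma 8.2, "Analysis of the final circuit C_final", p. 33)] -/
theorem l2Norm_toMatrix_sub_replMatrix_le_of_forall_le (hG : G.IsUnitary) {A : Language Bool}
    {g : ℕ → Language Bool} {D : ℕ → Set (List Bool)}
    (hD : ∀ t w, w ∉ D t → (w ∈ g t ↔ w ∈ A)) (i : ℕ) (gs : List (Cryptography.QGate G N))
    (ψ : Cryptography.QReg N → ℂ) {ε₁ : ℝ} (hε : ∀ q ∈ replQueryWeights g D i gs ψ, q ≤ ε₁) :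
    l2Norm ((⟨gs⟩ : Cryptography.QCircuit G N).toMatrix A *ᵥ ψ - replMatrix g i gs *ᵥ ψ) ≤
      2 * ((⟨gs⟩ : Cryptography.QCircuit G N).oracleQueries : ℝ) * Real.sqrt ε₁ := by
  refine (l2Norm_toMatrix_sub_replMatrix_le hG hD i gs ψ).trans ?_
  rw [← length_replQueryWeights g D i gs ψ]
  exact sum_map_two_mul_sqrt_le_of_forall_le hε

/-- Aaronson–Chen's numerical instance: with `ε₁ = ε⁴ / (256 T²)` (`T > 0`)
the bound `2T√ε₁` is `ε²/8`. [cite: AaronsonChen2017, §8 (proof of Lemma 8.2, choice of ε₁ and "= ε²/8", p. 33)] -/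
theorem two_mul_mul_sqrt_eq {T : ℝ} (hT : 0 < T) (ε : ℝ) :
    2 * T * Real.sqrt (ε ^ 4 / (256 * T ^ 2)) = ε ^ 2 / 8 := by
  have h : ε ^ 4 / (256 * T ^ 2) = (ε ^ 2 / (16 * T)) ^ 2 := by
    field_simp
    ring
  rw [h, Real.sqrt_sq (by positivity)]
  field_simp
  ring

/-- Hence, over a unitary gate set, if every replacement errs with query magnitude at most
`ε⁴/(256 T²)` then `‖U ψ − V ψ‖₂ ≤ ε²/8` (for `T ≥ 1`; with no oracle gate `U = V`).
[cite: AaronsonChen2017, §8 (proof of Lemma 8.2, p. 33)] -/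
theorem l2Norm_toMatrix_sub_replMatrix_le_sq_div_eight (hG : G.IsUnitary) {A : Language Bool}
    {g : ℕ → Language Bool} {D : ℕ → Set (List Bool)}
    (hD : ∀ t w, w ∉ D t → (w ∈ g t ↔ w ∈ A)) (i : ℕ) (gs : List (Cryptography.QGate G N))
    (ψ : Cryptography.QReg N → ℂ) (ε : ℝ)
    (hT : 0 < (⟨gs⟩ : Cryptography.QCircuit G N).oracleQueries)
    (hq : ∀ q ∈ replQueryWeights g D i gs ψ,
      q ≤ ε ^ 4 / (256 * ((⟨gs⟩ : Cryptography.QCircuit G N).oracleQueries : ℝ) ^ 2)) :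
    l2Norm ((⟨gs⟩ : Cryptography.QCircuit G N).toMatrix A *ᵥ ψ - replMatrix g i gs *ᵥ ψ) ≤ ε ^ 2 / 8 := by
  rw [← two_mul_mul_sqrt_eq (T := ((⟨gs⟩ : Cryptography.QCircuit G N).oracleQueries : ℝ))
    (Nat.cast_pos.2 hT) ε]
  exact l2Norm_toMatrix_sub_replMatrix_le_of_forall_le hG hD i gs ψ hq

end Literature.Computability.QuantumComplexity

end
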